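import Literature.NumberTheory.Sieve.ChenTwinUpperB
import HarnessLib

/-!
# Prime sums against monotone weights (tools for the cardinality step of Nathanson's Thm 10.6)

Topic `Literature/NumberTheory/Sieve`, family `parity`; companion of
`Literature.NumberTheory.Sieve.ChenTwinUpperB` (estimate (C) of the twin form of Chen's theorem).
The cardinality step of the proof of Nathanson, *Additive Number Theory: The Classical Bases*
(GTM 164), Theorem 10.6 (pp. 176–178 of the held copy) evaluates the double prime sum
`∑_{z ≤ p₁ < y} (1/p₁) ∑_{y ≤ p₂ < (X₁/p₁)^{1/2}} 1/(p₂ log(N/p₁p₂)) = (c + o(1))/log N` by two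
integrations by parts against `S(t) = ∑_{p<t} 1/p = log log t + B + O(1/log t)`. This file PROVES
the elementary tools for this, in a form avoiding Stieltjes integrals (everything here is a
theorem; no definitions, no named facts):

* `abs_sum_inv_primesBelow_sub_le`, `sum_inv_primes_window_le` — Mertens' second theorem with its
  rate for real cut-offs, `|∑_{p<t} 1/p − log log t − B| ≤ 17/log t` (`t ≥ 3`) and
  `∑_{u ≤ p < v} 1/p ≤ log(log v/log u) + 40/log u` (`3 ≤ u ≤ v`), from the tree's
  `Literature.NumberTheory.LFunctions.Mertens.abs_primeRecipSum_sub_le` (Hardy–Wright Thm 427);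
* `sum_window_le_sum_cells`, `exists_geomCells`,
  `sum_window_div_le_integral_of_monotoneOn` / `_of_antitoneOn` — **prime sums against a monotone
  weight**: for `x > 1`, `0 < β_a ≤ β_b`, `x^{β_a} ≥ 3`, `G` monotone on `[β_a, β_b]` with
  `0 ≤ G ≤ M`, and `N ≥ 1` cells,
  `∑_{x^{β_a} ≤ p < x^{β_b}} G(log p/log x)/p ≤ ∫_{β_a}^{β_b} G(β) dβ/β + M(log(β_b/β_a)/N + 40N/(β_a log x))`
  (geometric cells in `β`, Mertens on each cell, upper Riemann sums of monotone functions);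
* `integral_inv_mul_sub_eq` (`∫ dα/(α(c − α))`), `inner_integral_le` (the inner integral of
  Nathanson's `H(p₁)`, p. 177, bounded by `(log(2 − 3β) + 4/L)/(1 − β)`), and the outer weight
  `Ψ(β) = (log(2 − 3β) + 4/L)/(1 − β)`: `psi_nonneg`, `psi_le_two`, `psi_antitoneOn`,
  `integral_psi_div_le` (`∫_{1/8}^{a} Ψ(β) dβ/β ≤ c + 16/L`, `c = switchingConstant`, p. 178).

The double sum itself and the cardinality bound are in `ChenTwinUpperBCard.lean`.

## References

* M. B. Nathanson, *Additive Number Theory: The Classical Bases*, GTM 164 (1996), proof of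
  Thm 10.6, pp. 176–178 of the held copy. [Nathanson1996]
* G. H. Hardy, E. M. Wright, *An Introduction to the Theory of Numbers*, Thm 427 (Mertens' second
  theorem). [HardyWright2008]
-/

open Finset Filter Topology

noncomputable section

namespace Literature.NumberTheory.Sieve.Chen

open LFunctions.Mertens

/-! ### Mertens' second theorem on windows `u ≤ p < v` -/

/-- `∑_{p < t} 1/p` is within `17/log t` of `log log t + B` for real `t ≥ 3` (Mertens' second
theorem with rate, `Literature.NumberTheory.LFunctions.Mertens.abs_primeRecipSum_sub_le`, at the
integer `⌈t⌉ − 1 ∈ [t − 1, t)`). [cite: HardyWright2008, Thm 427 (§22.7)] -/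
theorem abs_sum_inv_primesBelow_sub_le {t : ℝ} (ht : 3 ≤ t) :
    |∑ p ∈ Nat.primesBelow ⌈t⌉₊, (1 : ℝ) / p - Real.log (Real.log t) - meisselMertens| ≤
      17 / Real.log t := by
  set n : ℕ := ⌈t⌉₊ - 1 with hn
  have h1 : (⌈t⌉₊ : ℝ) < t + 1 := Nat.ceil_lt_add_one (by linarith)
  have h2 : t ≤ (⌈t⌉₊ : ℝ) := Nat.le_ceil t
  have hc3 : 3 ≤ ⌈t⌉₊ := by
    have : ((3 : ℕ) : ℝ) ≤ (⌈t⌉₊ : ℝ) := by push_cast; linarith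
    exact_mod_cast this
  have hn2 : 2 ≤ n := by omega
  have hnr : (n : ℝ) = ⌈t⌉₊ - 1 := by
    rw [hn, Nat.cast_sub (by omega), Nat.cast_one]
  have hnt : (n : ℝ) < t := by rw [hnr]; linarith
  have htn : t - 1 ≤ n := by rw [hnr]; linarith
  have hn2r : (2 : ℝ) ≤ n := by exact_mod_cast hn2
  have hn0 : (0 : ℝ) < n := by linarith
  have hsum : ∑ p ∈ Nat.primesBelow ⌈t⌉₊, (1 : ℝ) / p = primeRecipSum n := by
    rw [Nat.primesBelow_eq_primesLE_sub_one, primeRecipSum, Nat.floor_natCast]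
    simp only [one_div]
    rfl
  have hM := abs_primeRecipSum_sub_le hn2r
  have hlogt : 0 < Real.log t := Real.log_pos (by linarith)
  have hlogn0 : 0 < Real.log n := Real.log_pos (by linarith)
  -- `log n ≥ log t / 2`
  have hlogn : Real.log t / 2 ≤ Real.log n := by
    have ha : Real.log t ≤ Real.log ((t - 1) ^ 2) :=
      Real.log_le_log (by linarith) (by nlinarith)
    rw [Real.log_pow] at ha
    have hb : Real.log (t - 1) ≤ Real.log n := Real.log_le_log (by linarith) htn
    push_cast at ha
    linarith
  -- `log log t − log log n ≤ 1/log t`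
  have hll0 : Real.log (Real.log n) ≤ Real.log (Real.log t) :=
    Real.log_le_log hlogn0 (Real.log_le_log hn0 hnt.le)
  have hll : Real.log (Real.log t) - Real.log (Real.log n) ≤ 1 / Real.log t := by
    have ha : Real.log (Real.log t) - Real.log (Real.log n) = Real.log (Real.log t / Real.log n) := by
      rw [Real.log_div hlogt.ne' hlogn0.ne']
    have hb : Real.log (Real.log t / Real.log n) ≤ Real.log t / Real.log n - 1 :=
      Real.log_le_sub_one_of_pos (div_pos hlogt hlogn0)
    have hc : Real.log t / Real.log n - 1 = (Real.log t - Real.log n) / Real.log n := by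
      field_simp
    have hd : Real.log t - Real.log n ≤ 1 / 2 := by
      have h' : Real.log t - Real.log n = Real.log (t / n) := by
        rw [Real.log_div (by linarith) hn0.ne']
      have h'' : Real.log (t / n) ≤ t / n - 1 := Real.log_le_sub_one_of_pos (div_pos (by linarith) hn0)
      have h''' : t / n - 1 ≤ 1 / 2 := by
        rw [div_sub_one hn0.ne', div_le_iff₀ hn0]
        linarith
      linarith
    rw [ha]
    calc Real.log (Real.log t / Real.log n) ≤ (Real.log t - Real.log n) / Real.log n := by rw [← hc]; exact hb
      _ ≤ (1 / 2) / (Real.log t / 2) := by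
          refine div_le_div₀ (by norm_num) hd (by positivity) hlogn
      _ = 1 / Real.log t := by field_simp
  -- combine
  have h8 : 8 / Real.log n ≤ 16 / Real.log t := by
    calc 8 / Real.log n ≤ 8 / (Real.log t / 2) := div_le_div_of_nonneg_left (by norm_num) (by positivity) hlogn
      _ = 16 / Real.log t := by field_simp; ring
  rw [hsum]
  have hsplit : primeRecipSum n - Real.log (Real.log t) - meisselMertens =
      (primeRecipSum n - Real.log (Real.log n) - meisselMertens) +
        (Real.log (Real.log n) - Real.log (Real.log t)) := by ring
  rw [hsplit]
  calc |(primeRecipSum n - Real.log (Real.log n) - meisselMertens) +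
        (Real.log (Real.log n) - Real.log (Real.log t))|
      ≤ |primeRecipSum n - Real.log (Real.log n) - meisselMertens| +
        |Real.log (Real.log n) - Real.log (Real.log t)| := abs_add_le _ _
    _ ≤ 16 / Real.log t + 1 / Real.log t := by
        refine add_le_add (hM.trans h8) ?_
        rw [abs_sub_comm, abs_of_nonneg (by linarith)]
        exact hll
    _ = 17 / Real.log t := by ring

/-- Sums over the primes below `v` split at `u ≤ v`. [folklore] -/
theorem sum_primesBelow_split {u v : ℝ} (huv : u ≤ v) (f : ℕ → ℝ) :
    ∑ p ∈ Nat.primesBelow ⌈v⌉₊, f p =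
      (∑ p ∈ Nat.primesBelow ⌈u⌉₊, f p) +
        ∑ p ∈ (Nat.primesBelow ⌈v⌉₊).filter (fun p : ℕ => u ≤ (p : ℝ)), f p := by
  rw [← Finset.sum_filter_add_sum_filter_not (Nat.primesBelow ⌈v⌉₊) (fun p : ℕ => u ≤ (p : ℝ)),
    primesBelow_ceil_filter_lt huv, add_comm]

/-- **Mertens' second theorem on a window**: for `3 ≤ u ≤ v`,
`∑_{u ≤ p < v} 1/p ≤ log(log v/log u) + 40/log u`. [cite: HardyWright2008, Thm 427 (§22.7)] -/
theorem sum_inv_primes_window_le {u v : ℝ} (hu : 3 ≤ u) (huv : u ≤ v) :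
    ∑ p ∈ (Nat.primesBelow ⌈v⌉₊).filter (fun p : ℕ => u ≤ (p : ℝ)), (1 : ℝ) / p ≤
      Real.log (Real.log v / Real.log u) + 40 / Real.log u := by
  have hv : 3 ≤ v := hu.trans huv
  have hlogu : 0 < Real.log u := Real.log_pos (by linarith)
  have hlogv : 0 < Real.log v := Real.log_pos (by linarith)
  have hsplit := sum_primesBelow_split huv (fun p : ℕ => (1 : ℝ) / p)
  obtain ⟨-, hv2⟩ := abs_le.mp (abs_sum_inv_primesBelow_sub_le hv)
  obtain ⟨hu1, -⟩ := abs_le.mp (abs_sum_inv_primesBelow_sub_le hu)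
  have h17 : 17 / Real.log v ≤ 17 / Real.log u :=
    div_le_div_of_nonneg_left (by norm_num) hlogu (Real.log_le_log (by linarith) huv)
  have hlog : Real.log (Real.log v) - Real.log (Real.log u) = Real.log (Real.log v / Real.log u) := by
    rw [Real.log_div hlogv.ne' hlogu.ne']
  have e40 : (40 : ℝ) / Real.log u = 17 / Real.log u + 17 / Real.log u + 6 / Real.log u := by ring
  have h6 : 0 ≤ 6 / Real.log u := by positivity
  linarith

/-! ### Prime sums against monotone weights: comparison with `∫ G(β) dβ/β` -/

/-- **Cell decomposition of a window sum.** Let `x > 1`, `0 < β_a < β_b` with `x^{β_a} ≥ 3`, and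
cell points `β_a = β₀ ≤ β₁ ≤ ⋯ ≤ β_N = β_b`. If `F(p) ≤ c_j` whenever `β_j ≤ log p/log x < β_{j+1}`
(`c_j ≥ 0`), then `∑_{x^{β_a} ≤ p < x^{β_b}} F(p)/p ≤ ∑_{j<N} c_j (log(β_{j+1}/β_j) + 40/(β_a log x))`
(each prime of the window lies in one cell; Mertens on each cell). [folklore] -/
theorem sum_window_le_sum_cells {x βa βb : ℝ} (hx : 1 < x) (hβa : 0 < βa)
    (h3 : 3 ≤ x ^ βa) {N : ℕ} (βpt : ℕ → ℝ) (h0 : βpt 0 = βa) (hNpt : βpt N = βb)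
    (hmono : Monotone βpt) (F : ℕ → ℝ) (c : ℕ → ℝ) (hc0 : ∀ j < N, 0 ≤ c j)
    (hmaj : ∀ p : ℕ, ∀ j < N, βpt j ≤ Real.log p / Real.log x →
      Real.log p / Real.log x < βpt (j + 1) → F p ≤ c j) :
    ∑ p ∈ (Nat.primesBelow ⌈x ^ βb⌉₊).filter (fun p : ℕ => x ^ βa ≤ (p : ℝ)), F p / p ≤
      ∑ j ∈ Finset.range N, c j * (Real.log (βpt (j + 1) / βpt j) + 40 / (βa * Real.log x)) := by
  classical
  have hx0 : 0 < x := by linarith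
  have hL : 0 < Real.log x := Real.log_pos hx
  set S := (Nat.primesBelow ⌈x ^ βb⌉₊).filter (fun p : ℕ => x ^ βa ≤ (p : ℝ)) with hS
  -- membership in the window
  have hmem : ∀ p ∈ S, p.Prime ∧ x ^ βa ≤ (p : ℝ) ∧ (p : ℝ) < x ^ βb := fun p hp => by
    rw [hS, Finset.mem_filter, Nat.mem_primesBelow] at hp
    exact ⟨hp.1.2, hp.2, Nat.lt_ceil.mp hp.1.1⟩
  have hpow : ∀ γ : ℝ, x ^ γ = Real.exp (Real.log x * γ) := fun γ => Real.rpow_def_of_pos hx0 γ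
  have hβ_of_mem : ∀ p ∈ S, βa ≤ Real.log p / Real.log x ∧ Real.log p / Real.log x < βb ∧
      (0 : ℝ) < p := by
    intro p hp
    obtain ⟨-, hpa, hpb⟩ := hmem p hp
    have hp0 : (0 : ℝ) < p := lt_of_lt_of_le (by linarith) hpa
    refine ⟨?_, ?_, hp0⟩
    · rw [le_div_iff₀ hL]
      have := Real.log_le_log (by positivity) hpa
      rwa [Real.log_rpow hx0] at this
    · rw [div_lt_iff₀ hL]
      have := Real.log_lt_log hp0 hpb
      rwa [Real.log_rpow hx0] at this
  -- the cell index of a prime of the window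
  set idx : ℕ → ℕ := fun p => Nat.findGreatest (fun j => βpt j ≤ Real.log p / Real.log x) N with hidx
  have hidx_props : ∀ p ∈ S, idx p < N ∧ βpt (idx p) ≤ Real.log p / Real.log x ∧
      Real.log p / Real.log x < βpt (idx p + 1) := by
    intro p hp
    obtain ⟨hβa', hβb', -⟩ := hβ_of_mem p hp
    have hP0 : βpt 0 ≤ Real.log p / Real.log x := by rw [h0]; exact hβa'
    have hspec : βpt (idx p) ≤ Real.log p / Real.log x :=
      Nat.findGreatest_spec (P := fun j => βpt j ≤ Real.log p / Real.log x) (Nat.zero_le N) hP0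
    have hle : idx p ≤ N := Nat.findGreatest_le N
    have hlt : idx p < N := by
      rcases hle.lt_or_eq with h | h
      · exact h
      · exfalso
        have : βpt N ≤ Real.log p / Real.log x := h ▸ hspec
        rw [hNpt] at this
        linarith
    refine ⟨hlt, hspec, ?_⟩
    by_contra hcon
    push Not at hcon
    exact Nat.findGreatest_is_greatest (P := fun j => βpt j ≤ Real.log p / Real.log x)
      (Nat.lt_succ_self (idx p)) hlt hcon
  -- Step 1: majorise termwise by the cell value
  have hstep1 : ∑ p ∈ S, F p / p ≤ ∑ p ∈ S, c (idx p) / p := by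
    refine Finset.sum_le_sum fun p hp => ?_
    obtain ⟨hlt, h1, h2⟩ := hidx_props p hp
    obtain ⟨-, -, hp0⟩ := hβ_of_mem p hp
    exact div_le_div_of_nonneg_right (hmaj p (idx p) hlt h1 h2) hp0.le
  -- Step 2: sum fibrewise over the cell index
  have hmaps : ∀ p ∈ S, idx p ∈ Finset.range N := fun p hp =>
    Finset.mem_range.mpr (hidx_props p hp).1
  have hstep2 : ∑ p ∈ S, c (idx p) / p =
      ∑ j ∈ Finset.range N, c j * ∑ p ∈ S.filter (fun p => idx p = j), (1 : ℝ) / p := by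
    rw [← Finset.sum_fiberwise_of_maps_to hmaps]
    refine Finset.sum_congr rfl fun j _ => ?_
    rw [Finset.mul_sum]
    refine Finset.sum_congr rfl fun p hp => ?_
    rw [(Finset.mem_filter.mp hp).2]
    ring
  -- Step 3: each fibre lies in a cell, where Mertens applies
  have hstep3 : ∀ j ∈ Finset.range N, ∑ p ∈ S.filter (fun p => idx p = j), (1 : ℝ) / p ≤
      Real.log (βpt (j + 1) / βpt j) + 40 / (βa * Real.log x) := by
    intro j hj
    have hβj : βa ≤ βpt j := h0 ▸ hmono (Nat.zero_le j)
    have hβj0 : 0 < βpt j := lt_of_lt_of_le hβa hβj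
    have hu3 : 3 ≤ x ^ βpt j := h3.trans (Real.rpow_le_rpow_of_exponent_le hx.le hβj)
    have huv : x ^ βpt j ≤ x ^ βpt (j + 1) :=
      Real.rpow_le_rpow_of_exponent_le hx.le (hmono (Nat.le_succ j))
    have hsub : S.filter (fun p => idx p = j) ⊆
        (Nat.primesBelow ⌈x ^ βpt (j + 1)⌉₊).filter (fun p : ℕ => x ^ βpt j ≤ (p : ℝ)) := by
      intro p hp
      rw [Finset.mem_filter] at hp
      obtain ⟨hpS, hpj⟩ := hp
      obtain ⟨-, h1, h2⟩ := hidx_props p hpS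
      rw [hpj] at h1 h2
      obtain ⟨hprime, -, -⟩ := hmem p hpS
      obtain ⟨-, -, hp0⟩ := hβ_of_mem p hpS
      rw [Finset.mem_filter, Nat.mem_primesBelow, Nat.lt_ceil]
      refine ⟨⟨?_, hprime⟩, ?_⟩
      · rw [hpow, ← Real.exp_log hp0, Real.exp_lt_exp]
        rwa [div_lt_iff₀ hL, mul_comm] at h2
      · rw [hpow, ← Real.exp_log hp0, Real.exp_le_exp]
        rwa [le_div_iff₀ hL, mul_comm] at h1
    calc ∑ p ∈ S.filter (fun p => idx p = j), (1 : ℝ) / p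
        ≤ ∑ p ∈ (Nat.primesBelow ⌈x ^ βpt (j + 1)⌉₊).filter (fun p : ℕ => x ^ βpt j ≤ (p : ℝ)),
            (1 : ℝ) / p :=
          Finset.sum_le_sum_of_subset_of_nonneg hsub fun p _ _ => by positivity
      _ ≤ Real.log (Real.log (x ^ βpt (j + 1)) / Real.log (x ^ βpt j)) + 40 / Real.log (x ^ βpt j) :=
          sum_inv_primes_window_le hu3 huv
      _ = Real.log (βpt (j + 1) / βpt j) + 40 / (βpt j * Real.log x) := by
          rw [Real.log_rpow hx0, Real.log_rpow hx0, mul_div_mul_right _ _ hL.ne']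
      _ ≤ Real.log (βpt (j + 1) / βpt j) + 40 / (βa * Real.log x) := by
          gcongr
  -- assemble
  calc ∑ p ∈ S, F p / p ≤ ∑ p ∈ S, c (idx p) / p := hstep1
    _ = ∑ j ∈ Finset.range N, c j * ∑ p ∈ S.filter (fun p => idx p = j), (1 : ℝ) / p := hstep2
    _ ≤ ∑ j ∈ Finset.range N, c j * (Real.log (βpt (j + 1) / βpt j) + 40 / (βa * Real.log x)) :=
        Finset.sum_le_sum fun j hj => mul_le_mul_of_nonneg_left (hstep3 j hj) (hc0 j (Finset.mem_range.mp hj))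

/-- **Geometric cells.** For `0 < β_a < β_b` and `N ≥ 1` the points `β_j = β_a (β_b/β_a)^{j/N}`
satisfy `β₀ = β_a`, `β_N = β_b`, are nondecreasing, lie in `[β_a, β_b]` for `j ≤ N`, are positive, and
`log(β_{j+1}/β_j) = log(β_b/β_a)/N`. [folklore] -/
theorem exists_geomCells {βa βb : ℝ} (hβa : 0 < βa) (hab : βa < βb) {N : ℕ} (hN : 0 < N) :
    ∃ βpt : ℕ → ℝ, βpt 0 = βa ∧ βpt N = βb ∧ Monotone βpt ∧ (∀ j, βa ≤ βpt j) ∧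
      (∀ j, j ≤ N → βpt j ≤ βb) ∧ (∀ j, 0 < βpt j) ∧
      ∀ j, Real.log (βpt (j + 1) / βpt j) = Real.log (βb / βa) / N := by
  set ρ := βb / βa with hρ
  have hρ1 : 1 < ρ := by rw [hρ, lt_div_iff₀ hβa]; linarith
  have hρ0 : 0 < ρ := by linarith
  have hN0 : (0 : ℝ) < N := by exact_mod_cast hN
  refine ⟨fun j => βa * ρ ^ ((j : ℝ) / N), ?_, ?_, ?_, ?_, ?_, ?_, ?_⟩
  · simp
  · show βa * ρ ^ ((N : ℝ) / N) = βb
    rw [div_self hN0.ne', Real.rpow_one, hρ, mul_div_cancel₀ _ hβa.ne']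
  · intro i j hij
    dsimp only
    refine mul_le_mul_of_nonneg_left ?_ hβa.le
    exact Real.rpow_le_rpow_of_exponent_le hρ1.le (by gcongr)
  · intro j
    show βa ≤ βa * ρ ^ ((j : ℝ) / N)
    have : (1 : ℝ) ≤ ρ ^ ((j : ℝ) / N) := Real.one_le_rpow hρ1.le (by positivity)
    nlinarith
  · intro j hj
    show βa * ρ ^ ((j : ℝ) / N) ≤ βb
    have hle : ρ ^ ((j : ℝ) / N) ≤ ρ ^ (1 : ℝ) := by
      refine Real.rpow_le_rpow_of_exponent_le hρ1.le ?_
      rw [div_le_one hN0]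
      exact_mod_cast hj
    rw [Real.rpow_one] at hle
    calc βa * ρ ^ ((j : ℝ) / N) ≤ βa * ρ := mul_le_mul_of_nonneg_left hle hβa.le
      _ = βb := by rw [hρ, mul_div_cancel₀ _ hβa.ne']
  · intro j
    show 0 < βa * ρ ^ ((j : ℝ) / N)
    exact mul_pos hβa (Real.rpow_pos_of_pos hρ0 _)
  · intro j
    show Real.log (βa * ρ ^ (((j + 1 : ℕ) : ℝ) / N) / (βa * ρ ^ ((j : ℝ) / N))) = Real.log ρ / N
    rw [mul_div_mul_left _ _ hβa.ne', ← Real.rpow_sub hρ0, Real.log_rpow hρ0]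
    push_cast
    field_simp
    ring

/-- Integrability of `G(β)/β` on a cell where `G` is monotone or antitone and `β > 0`. [folklore] -/
theorem intervalIntegrable_div_of_monotoneOn_or_antitoneOn {G : ℝ → ℝ} {a b : ℝ} (ha : 0 < a)
    (hab : a ≤ b) (hG : MonotoneOn G (Set.Icc a b) ∨ AntitoneOn G (Set.Icc a b)) :
    IntervalIntegrable (fun β => G β / β) MeasureTheory.volume a b := by
  have hGi : IntervalIntegrable G MeasureTheory.volume a b := by
    rcases hG with h | h
    · exact (show MonotoneOn G (Set.uIcc a b) by rwa [Set.uIcc_of_le hab]).intervalIntegrable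
    · exact (show AntitoneOn G (Set.uIcc a b) by rwa [Set.uIcc_of_le hab]).intervalIntegrable
  have hcont : ContinuousOn (fun β : ℝ => 1 / β) (Set.uIcc a b) := by
    refine continuousOn_const.div continuousOn_id fun β hβ => ?_
    rw [Set.uIcc_of_le hab] at hβ
    exact (lt_of_lt_of_le ha hβ.1).ne'
  have h := hGi.mul_continuousOn hcont
  have hfun : (fun β => G β / β) = fun β => G β * (1 / β) := by
    funext β; rw [div_eq_mul_one_div]
  rw [hfun]
  exact h

/-- `∫_a^b C dβ/β = C log(b/a)` for `0 < a, b`. [folklore] -/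
theorem integral_const_div_eq {a b : ℝ} (ha : 0 < a) (hb : 0 < b) (C : ℝ) :
    ∫ β in a..b, C / β = C * Real.log (b / a) := by
  have hfun : (fun β : ℝ => C / β) = fun β => C * (1 / β) := by
    funext β; rw [div_eq_mul_one_div]
  rw [hfun, intervalIntegral.integral_const_mul, integral_one_div_of_pos ha hb]

/-- **Prime sums against a nondecreasing weight.** For `x > 1`, `0 < β_a ≤ β_b` with `x^{β_a} ≥ 3`,
`G` nondecreasing on `[β_a, β_b]` with `0 ≤ G ≤ M` there, and every `N ≥ 1`:
`∑_{x^{β_a} ≤ p < x^{β_b}} G(log p/log x)/p ≤ ∫_{β_a}^{β_b} G(β) dβ/β + M (log(β_b/β_a)/N + 40N/(β_a log x))`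
(cells `β_j = β_a(β_b/β_a)^{j/N}`, Mertens' second theorem with rate on each cell, and the upper
Riemann sum of a monotone function). This is the form in which "integration by parts against
`S(t) = log log t + B + O(1/log t)`" (Nathanson, proof of Thm 10.6, pp. 176–178) is used here.
[cite: Nathanson1996, Thm 10.6 (proof, pp. 176–178)] -/
theorem sum_window_div_le_integral_of_monotoneOn {x βa βb M : ℝ} (hx : 1 < x)
    (hβa : 0 < βa) (hab : βa ≤ βb) (h3 : 3 ≤ x ^ βa) {G : ℝ → ℝ}
    (hG : MonotoneOn G (Set.Icc βa βb)) (hG0 : ∀ β ∈ Set.Icc βa βb, 0 ≤ G β)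
    (hGM : ∀ β ∈ Set.Icc βa βb, G β ≤ M) {N : ℕ} (hN : 0 < N) :
    ∑ p ∈ (Nat.primesBelow ⌈x ^ βb⌉₊).filter (fun p : ℕ => x ^ βa ≤ (p : ℝ)),
        G (Real.log p / Real.log x) / p ≤
      (∫ β in βa..βb, G β / β) + M * (Real.log (βb / βa) / N + 40 * N / (βa * Real.log x)) := by
  have hx0 : 0 < x := by linarith
  have hL : 0 < Real.log x := Real.log_pos hx
  have hN0 : (0 : ℝ) < N := by exact_mod_cast hN
  have hM0 : 0 ≤ M := (hG0 βa ⟨le_rfl, hab⟩).trans (hGM βa ⟨le_rfl, hab⟩)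
  rcases hab.eq_or_lt with heq | hlt
  · -- empty window
    subst heq
    have hempty : (Nat.primesBelow ⌈x ^ βa⌉₊).filter (fun p : ℕ => x ^ βa ≤ (p : ℝ)) = ∅ := by
      refine Finset.filter_false_of_mem fun p hp => ?_
      rw [Nat.mem_primesBelow, Nat.lt_ceil] at hp
      exact not_le.mpr hp.1
    rw [hempty, Finset.sum_empty, intervalIntegral.integral_same, div_self hβa.ne', Real.log_one,
      zero_div, zero_add, zero_add]
    positivity
  -- the cells
  obtain ⟨βpt, h0, hNpt, hmono, hge, hle, hpos, hlog⟩ := exists_geomCells hβa hlt hN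
  set Δ := Real.log (βb / βa) / N with hΔ
  have hΔ0 : 0 ≤ Δ := div_nonneg (Real.log_nonneg (by rw [le_div_iff₀ hβa]; linarith)) hN0.le
  have hmemIcc : ∀ j, j ≤ N → βpt j ∈ Set.Icc βa βb := fun j hj => ⟨hge j, hle j hj⟩
  -- the cell decomposition with `c_j = G(β_{j+1})`
  have hcells := sum_window_le_sum_cells hx hβa h3 βpt h0 hNpt hmono
    (fun p : ℕ => G (Real.log p / Real.log x)) (fun j => G (βpt (j + 1)))
    (fun j hj => hG0 _ (hmemIcc (j + 1) (by omega))) (fun p j hj h1 h2 => ?_)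
  swap
  · have hβmem : Real.log p / Real.log x ∈ Set.Icc βa βb :=
      ⟨(hge j).trans h1, h2.le.trans (hle (j + 1) (by omega))⟩
    exact hG hβmem (hmemIcc (j + 1) (by omega)) h2.le
  -- split the cell sum
  have hsplit : ∑ j ∈ Finset.range N, G (βpt (j + 1)) *
        (Real.log (βpt (j + 1) / βpt j) + 40 / (βa * Real.log x)) =
      (∑ j ∈ Finset.range N, G (βpt (j + 1))) * Δ +
        (∑ j ∈ Finset.range N, G (βpt (j + 1))) * (40 / (βa * Real.log x)) := by
    rw [Finset.sum_mul, Finset.sum_mul, ← Finset.sum_add_distrib]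
    refine Finset.sum_congr rfl fun j _ => ?_
    rw [hlog j]
    ring
  have hsumG : ∑ j ∈ Finset.range N, G (βpt (j + 1)) ≤ N * M := by
    calc ∑ j ∈ Finset.range N, G (βpt (j + 1)) ≤ ∑ j ∈ Finset.range N, M :=
          Finset.sum_le_sum fun j hj => hGM _ (hmemIcc (j + 1) (by
            have := Finset.mem_range.mp hj; omega))
      _ = N * M := by rw [Finset.sum_const, Finset.card_range, nsmul_eq_mul]
  -- Riemann: `∑_j G(β_{j+1}) Δ ≤ ∫ + M Δ`
  have hint : ∀ j < N, IntervalIntegrable (fun β => G β / β) MeasureTheory.volume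
      (βpt j) (βpt (j + 1)) := fun j hj =>
    intervalIntegrable_div_of_monotoneOn_or_antitoneOn (hpos j) (hmono (Nat.le_succ j))
      (Or.inl (hG.mono (Set.Icc_subset_Icc (hge j) (hle (j + 1) (by omega)))))
  have hcellint : ∀ j < N, G (βpt j) * Δ ≤ ∫ β in βpt j..βpt (j + 1), G β / β := by
    intro j hj
    have hjj : βpt j ≤ βpt (j + 1) := hmono (Nat.le_succ j)
    rw [← hlog j, ← integral_const_div_eq (hpos j) (hpos (j + 1))]
    refine intervalIntegral.integral_mono_on hjj ?_ (hint j hj) fun β hβ => ?_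
    · refine ContinuousOn.intervalIntegrable ?_
      refine continuousOn_const.div continuousOn_id fun β hβ => ?_
      rw [Set.uIcc_of_le hjj] at hβ
      exact (lt_of_lt_of_le (hpos j) hβ.1).ne'
    · have hβ0 : 0 < β := lt_of_lt_of_le (hpos j) hβ.1
      have hβmem : β ∈ Set.Icc βa βb := ⟨(hge j).trans hβ.1, hβ.2.trans (hle (j + 1) (by omega))⟩
      exact div_le_div_of_nonneg_right (hG (hmemIcc j hj.le) hβmem hβ.1) hβ0.le
  have hRiemann : (∑ j ∈ Finset.range N, G (βpt (j + 1))) * Δ ≤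
      (∫ β in βa..βb, G β / β) + M * Δ := by
    have h1 : (∑ j ∈ Finset.range N, G (βpt j)) * Δ ≤ ∫ β in (βpt 0)..(βpt N), G β / β := by
      rw [Finset.sum_mul, ← intervalIntegral.sum_integral_adjacent_intervals hint]
      exact Finset.sum_le_sum fun j hj => hcellint j (Finset.mem_range.mp hj)
    rw [h0, hNpt] at h1
    have h2 : ∑ j ∈ Finset.range N, G (βpt (j + 1)) =
        ∑ j ∈ Finset.range N, G (βpt j) + (G (βpt N) - G (βpt 0)) := by
      have ha := Finset.sum_range_succ (fun j => G (βpt j)) N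
      have hb := Finset.sum_range_succ' (fun j => G (βpt j)) N
      linarith
    have h3 : (G (βpt N) - G (βpt 0)) * Δ ≤ M * Δ := by
      refine mul_le_mul_of_nonneg_right ?_ hΔ0
      rw [h0, hNpt]
      linarith [hGM βb ⟨hlt.le, le_rfl⟩, hG0 βa ⟨le_rfl, hlt.le⟩]
    rw [h2, add_mul]
    linarith
  -- final
  calc ∑ p ∈ (Nat.primesBelow ⌈x ^ βb⌉₊).filter (fun p : ℕ => x ^ βa ≤ (p : ℝ)),
        G (Real.log p / Real.log x) / p
      ≤ ∑ j ∈ Finset.range N, G (βpt (j + 1)) *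
          (Real.log (βpt (j + 1) / βpt j) + 40 / (βa * Real.log x)) := hcells
    _ = (∑ j ∈ Finset.range N, G (βpt (j + 1))) * Δ +
          (∑ j ∈ Finset.range N, G (βpt (j + 1))) * (40 / (βa * Real.log x)) := hsplit
    _ ≤ ((∫ β in βa..βb, G β / β) + M * Δ) + (N * M) * (40 / (βa * Real.log x)) :=
        add_le_add hRiemann (mul_le_mul_of_nonneg_right hsumG (by positivity))
    _ = (∫ β in βa..βb, G β / β) + M * (Real.log (βb / βa) / N + 40 * N / (βa * Real.log x)) := by
        rw [hΔ]
        ring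

/-- **Prime sums against a nonincreasing weight**: the analogue of
`sum_window_div_le_integral_of_monotoneOn` for `G` nonincreasing on `[β_a, β_b]`.
[cite: Nathanson1996, Thm 10.6 (proof, pp. 176–178)] -/
theorem sum_window_div_le_integral_of_antitoneOn {x βa βb M : ℝ} (hx : 1 < x)
    (hβa : 0 < βa) (hab : βa ≤ βb) (h3 : 3 ≤ x ^ βa) {G : ℝ → ℝ}
    (hG : AntitoneOn G (Set.Icc βa βb)) (hG0 : ∀ β ∈ Set.Icc βa βb, 0 ≤ G β)
    (hGM : ∀ β ∈ Set.Icc βa βb, G β ≤ M) {N : ℕ} (hN : 0 < N) :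
    ∑ p ∈ (Nat.primesBelow ⌈x ^ βb⌉₊).filter (fun p : ℕ => x ^ βa ≤ (p : ℝ)),
        G (Real.log p / Real.log x) / p ≤
      (∫ β in βa..βb, G β / β) + M * (Real.log (βb / βa) / N + 40 * N / (βa * Real.log x)) := by
  have hx0 : 0 < x := by linarith
  have hL : 0 < Real.log x := Real.log_pos hx
  have hN0 : (0 : ℝ) < N := by exact_mod_cast hN
  have hM0 : 0 ≤ M := (hG0 βa ⟨le_rfl, hab⟩).trans (hGM βa ⟨le_rfl, hab⟩)
  rcases hab.eq_or_lt with heq | hlt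
  · subst heq
    have hempty : (Nat.primesBelow ⌈x ^ βa⌉₊).filter (fun p : ℕ => x ^ βa ≤ (p : ℝ)) = ∅ := by
      refine Finset.filter_false_of_mem fun p hp => ?_
      rw [Nat.mem_primesBelow, Nat.lt_ceil] at hp
      exact not_le.mpr hp.1
    rw [hempty, Finset.sum_empty, intervalIntegral.integral_same, div_self hβa.ne', Real.log_one,
      zero_div, zero_add, zero_add]
    positivity
  obtain ⟨βpt, h0, hNpt, hmono, hge, hle, hpos, hlog⟩ := exists_geomCells hβa hlt hN
  set Δ := Real.log (βb / βa) / N with hΔ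
  have hΔ0 : 0 ≤ Δ := div_nonneg (Real.log_nonneg (by rw [le_div_iff₀ hβa]; linarith)) hN0.le
  have hmemIcc : ∀ j, j ≤ N → βpt j ∈ Set.Icc βa βb := fun j hj => ⟨hge j, hle j hj⟩
  -- the cell decomposition with `c_j = G(β_j)`
  have hcells := sum_window_le_sum_cells hx hβa h3 βpt h0 hNpt hmono
    (fun p : ℕ => G (Real.log p / Real.log x)) (fun j => G (βpt j))
    (fun j hj => hG0 _ (hmemIcc j hj.le)) (fun p j hj h1 h2 => ?_)
  swap
  · have hβmem : Real.log p / Real.log x ∈ Set.Icc βa βb :=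
      ⟨(hge j).trans h1, h2.le.trans (hle (j + 1) (by omega))⟩
    exact hG (hmemIcc j hj.le) hβmem h1
  have hsplit : ∑ j ∈ Finset.range N, G (βpt j) *
        (Real.log (βpt (j + 1) / βpt j) + 40 / (βa * Real.log x)) =
      (∑ j ∈ Finset.range N, G (βpt j)) * Δ +
        (∑ j ∈ Finset.range N, G (βpt j)) * (40 / (βa * Real.log x)) := by
    rw [Finset.sum_mul, Finset.sum_mul, ← Finset.sum_add_distrib]
    refine Finset.sum_congr rfl fun j _ => ?_
    rw [hlog j]
    ring
  have hsumG : ∑ j ∈ Finset.range N, G (βpt j) ≤ N * M := by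
    calc ∑ j ∈ Finset.range N, G (βpt j) ≤ ∑ j ∈ Finset.range N, M :=
          Finset.sum_le_sum fun j hj => hGM _ (hmemIcc j (Finset.mem_range.mp hj).le)
      _ = N * M := by rw [Finset.sum_const, Finset.card_range, nsmul_eq_mul]
  have hint : ∀ j < N, IntervalIntegrable (fun β => G β / β) MeasureTheory.volume
      (βpt j) (βpt (j + 1)) := fun j hj =>
    intervalIntegrable_div_of_monotoneOn_or_antitoneOn (hpos j) (hmono (Nat.le_succ j))
      (Or.inr (hG.mono (Set.Icc_subset_Icc (hge j) (hle (j + 1) (by omega)))))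
  have hcellint : ∀ j < N, G (βpt (j + 1)) * Δ ≤ ∫ β in βpt j..βpt (j + 1), G β / β := by
    intro j hj
    have hjj : βpt j ≤ βpt (j + 1) := hmono (Nat.le_succ j)
    rw [← hlog j, ← integral_const_div_eq (hpos j) (hpos (j + 1))]
    refine intervalIntegral.integral_mono_on hjj ?_ (hint j hj) fun β hβ => ?_
    · refine ContinuousOn.intervalIntegrable ?_
      refine continuousOn_const.div continuousOn_id fun β hβ => ?_
      rw [Set.uIcc_of_le hjj] at hβ
      exact (lt_of_lt_of_le (hpos j) hβ.1).ne'
    · have hβ0 : 0 < β := lt_of_lt_of_le (hpos j) hβ.1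
      have hβmem : β ∈ Set.Icc βa βb := ⟨(hge j).trans hβ.1, hβ.2.trans (hle (j + 1) (by omega))⟩
      exact div_le_div_of_nonneg_right (hG hβmem (hmemIcc (j + 1) (by omega)) hβ.2) hβ0.le
  have hRiemann : (∑ j ∈ Finset.range N, G (βpt j)) * Δ ≤
      (∫ β in βa..βb, G β / β) + M * Δ := by
    have h1 : (∑ j ∈ Finset.range N, G (βpt (j + 1))) * Δ ≤ ∫ β in (βpt 0)..(βpt N), G β / β := by
      rw [Finset.sum_mul, ← intervalIntegral.sum_integral_adjacent_intervals hint]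
      exact Finset.sum_le_sum fun j hj => hcellint j (Finset.mem_range.mp hj)
    rw [h0, hNpt] at h1
    have h2 : ∑ j ∈ Finset.range N, G (βpt j) =
        ∑ j ∈ Finset.range N, G (βpt (j + 1)) + (G (βpt 0) - G (βpt N)) := by
      have ha := Finset.sum_range_succ (fun j => G (βpt j)) N
      have hb := Finset.sum_range_succ' (fun j => G (βpt j)) N
      linarith
    have h3 : (G (βpt 0) - G (βpt N)) * Δ ≤ M * Δ := by
      refine mul_le_mul_of_nonneg_right ?_ hΔ0
      rw [h0, hNpt]
      linarith [hGM βa ⟨le_rfl, hlt.le⟩, hG0 βb ⟨hlt.le, le_rfl⟩]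
    rw [h2, add_mul]
    linarith
  calc ∑ p ∈ (Nat.primesBelow ⌈x ^ βb⌉₊).filter (fun p : ℕ => x ^ βa ≤ (p : ℝ)),
        G (Real.log p / Real.log x) / p
      ≤ ∑ j ∈ Finset.range N, G (βpt j) *
          (Real.log (βpt (j + 1) / βpt j) + 40 / (βa * Real.log x)) := hcells
    _ = (∑ j ∈ Finset.range N, G (βpt j)) * Δ +
          (∑ j ∈ Finset.range N, G (βpt j)) * (40 / (βa * Real.log x)) := hsplit
    _ ≤ ((∫ β in βa..βb, G β / β) + M * Δ) + (N * M) * (40 / (βa * Real.log x)) :=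
        add_le_add hRiemann (mul_le_mul_of_nonneg_right hsumG (by positivity))
    _ = (∫ β in βa..βb, G β / β) + M * (Real.log (βb / βa) / N + 40 * N / (βa * Real.log x)) := by
        rw [hΔ]
        ring

/-! ### The inner integral `∫ dα/(α(c − α))` and its bound -/

/-- `∫_a^b dα/(α(c − α)) = (log(b/(c−b)) − log(a/(c−a)))/c` for `0 < a ≤ b < c`
(antiderivative `(log α − log(c − α))/c`). [folklore] -/
theorem integral_inv_mul_sub_eq {a b c : ℝ} (ha : 0 < a) (hab : a ≤ b) (hbc : b < c) :
    ∫ α in a..b, 1 / (α * (c - α)) = (Real.log (b / (c - b)) - Real.log (a / (c - a))) / c := by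
  have hc : 0 < c := by linarith
  set F : ℝ → ℝ := fun α => (Real.log α - Real.log (c - α)) / c with hF
  have hderiv : ∀ α ∈ Set.uIcc a b, HasDerivAt F (1 / (α * (c - α))) α := by
    intro α hα
    rw [Set.uIcc_of_le hab] at hα
    have hα0 : 0 < α := lt_of_lt_of_le ha hα.1
    have hcα : 0 < c - α := by linarith [hα.2]
    have h1 : HasDerivAt (fun α => Real.log α) α⁻¹ α := Real.hasDerivAt_log hα0.ne'
    have h2 : HasDerivAt (fun α => Real.log (c - α)) ((-1) / (c - α)) α := by
      have h := ((hasDerivAt_id α).const_sub c).log hcα.ne'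
      simpa using h
    have h3 := (h1.sub h2).div_const c
    refine h3.congr_deriv ?_
    field_simp
    ring
  have hcont : ContinuousOn (fun α : ℝ => 1 / (α * (c - α))) (Set.uIcc a b) := by
    rw [Set.uIcc_of_le hab]
    refine continuousOn_const.div (continuousOn_id.mul (continuousOn_const.sub continuousOn_id))
      fun α hα => ?_
    have hα0 : 0 < α := lt_of_lt_of_le ha hα.1
    have hcα : 0 < c - α := by linarith [hα.2]
    exact (mul_pos hα0 hcα).ne'
  rw [intervalIntegral.integral_eq_sub_of_hasDerivAt hderiv hcont.intervalIntegrable, hF]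
  have hb0 : 0 < b := lt_of_lt_of_le ha hab
  have hcb : 0 < c - b := by linarith
  have hca : 0 < c - a := by linarith
  simp only
  rw [Real.log_div hb0.ne' hcb.ne', Real.log_div ha.ne' hca.ne']
  ring

/-- **The inner integral of the cardinality computation** (Nathanson p. 177: `H(p₁)` and its
evaluation). With `β = log p₁/log x ∈ [1/8, a_Y)`, `a_Y = log y/log x ∈ [1/3, 7/20]`,
`ℓ₁ = log X₁/log x ∈ [1, 1 + 4/(5L)]` (`X₁ = (1+ε)(x+2)`, `L = log x ≥ 10`) and `b_W = (ℓ₁ − β)/2`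
(`W = (X₁/p₁)^{1/2}`): if `a_Y ≤ b_W` then
`[log(b_W/(1−β−b_W)) − log(a_Y/(1−β−a_Y))]/(1−β) ≤ (log(2 − 3β) + 4/L)/(1 − β)`.
[cite: Nathanson1996, Thm 10.6 (proof, p. 177)] -/
theorem inner_integral_le {L β aY ℓ₁ : ℝ} (hL : 10 ≤ L) (hβ : 1 / 8 ≤ β) (hβa : β < aY)
    (haY : 1 / 3 ≤ aY) (haY' : aY ≤ 7 / 20) (hℓ₁ : 1 ≤ ℓ₁) (hℓ₁' : ℓ₁ ≤ 1 + 4 / (5 * L)) :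
    (Real.log ((ℓ₁ - β) / 2 / (1 - β - (ℓ₁ - β) / 2)) - Real.log (aY / (1 - β - aY))) / (1 - β) ≤
      (Real.log (2 - 3 * β) + 4 / L) / (1 - β) := by
  have hL0 : 0 < L := by linarith
  have h1β : 0 < 1 - β := by linarith
  have h45 : 4 / (5 * L) ≤ 4 / 50 := div_le_div_of_nonneg_left (by norm_num) (by norm_num) (by linarith)
  -- the upper endpoint
  have hD : 1 / 2 ≤ 2 - β - ℓ₁ := by linarith
  have hratio : (ℓ₁ - β) / 2 / (1 - β - (ℓ₁ - β) / 2) = (ℓ₁ - β) / (2 - β - ℓ₁) := by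
    have : 1 - β - (ℓ₁ - β) / 2 = (2 - β - ℓ₁) / 2 := by ring
    rw [this, div_div_div_cancel_right₀ (by norm_num : (2 : ℝ) ≠ 0)]
  have hup : Real.log ((ℓ₁ - β) / 2 / (1 - β - (ℓ₁ - β) / 2)) ≤ 4 / L := by
    rw [hratio]
    have hpos : 0 < (ℓ₁ - β) / (2 - β - ℓ₁) := div_pos (by linarith) (by linarith)
    calc Real.log ((ℓ₁ - β) / (2 - β - ℓ₁)) ≤ (ℓ₁ - β) / (2 - β - ℓ₁) - 1 :=
          Real.log_le_sub_one_of_pos hpos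
      _ = (2 * ℓ₁ - 2) / (2 - β - ℓ₁) := by field_simp; ring
      _ ≤ (2 * ℓ₁ - 2) / (1 / 2) := div_le_div_of_nonneg_left (by linarith) (by norm_num) hD
      _ = 4 * (ℓ₁ - 1) := by ring
      _ ≤ 4 * (4 / (5 * L)) := by linarith
      _ ≤ 4 / L := by
          rw [show 4 * (4 / (5 * L)) = (16 / 5) / L by ring]
          exact div_le_div_of_nonneg_right (by norm_num) hL0.le
  -- the lower endpoint
  have hcaY : 0 < 1 - β - aY := by linarith
  have haY0 : 0 < aY := by linarith
  have hlow : -Real.log (aY / (1 - β - aY)) ≤ Real.log (2 - 3 * β) := by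
    rw [← Real.log_inv, inv_div]
    refine Real.log_le_log (div_pos hcaY haY0) ?_
    rw [div_le_iff₀ haY0]
    nlinarith
  rw [div_le_div_iff_of_pos_right h1β]
  linarith

/-! ### The outer weight `Ψ(β) = (log(2 − 3β) + 4/L)/(1 − β)` -/

/-- `Ψ ≥ 0` on `(-∞, 1/3 + 1/(2L)]` for `L ≥ 10`. [folklore] -/
theorem psi_nonneg {L β : ℝ} (hL : 10 ≤ L) (hβ' : β ≤ 1 / 3 + 1 / (2 * L)) :
    0 ≤ (Real.log (2 - 3 * β) + 4 / L) / (1 - β) := by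
  have hL0 : 0 < L := by linarith
  have h1β : 0 < 1 - β := by
    have : 1 / (2 * L) ≤ 1 / 20 := div_le_div_of_nonneg_left (by norm_num) (by norm_num) (by linarith)
    linarith
  refine div_nonneg ?_ h1β.le
  have hw : 2 - 3 * β ≥ 1 - 3 / (2 * L) := by
    have : 3 * β ≤ 1 + 3 / (2 * L) := by
      calc 3 * β ≤ 3 * (1 / 3 + 1 / (2 * L)) := by linarith
        _ = 1 + 3 / (2 * L) := by ring
    linarith
  have hwpos : 0 < 1 - 3 / (2 * L) := by
    have : 3 / (2 * L) ≤ 3 / 20 := div_le_div_of_nonneg_left (by norm_num) (by norm_num) (by linarith)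
    linarith
  have hpos : 0 < 2 - 3 * β := by linarith
  have hlog : Real.log (1 - 3 / (2 * L)) ≤ Real.log (2 - 3 * β) := Real.log_le_log hwpos hw
  have hlog2 : 1 - (1 - 3 / (2 * L))⁻¹ ≤ Real.log (1 - 3 / (2 * L)) :=
    Real.one_sub_inv_le_log_of_pos hwpos
  -- `1 - 1/(1-w) = -w/(1-w) ≥ -2w`, `w = 3/(2L) ≤ 3/20`
  have hinv : (1 - 3 / (2 * L))⁻¹ ≤ 1 + 4 / L := by
    rw [inv_le_iff_one_le_mul₀ hwpos]
    have : 3 / (2 * L) * (4 / L) ≤ 3 / 20 * (4 / L) := by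
      refine mul_le_mul_of_nonneg_right ?_ (by positivity)
      exact div_le_div_of_nonneg_left (by norm_num) (by norm_num) (by linarith)
    nlinarith [show (0 : ℝ) < 4 / L by positivity, show 3 / (2 * L) = 3 / 2 * (1 / L) by ring,
      show 4 / L = 4 * (1 / L) by ring, show 0 < 1 / L by positivity]
  linarith

/-- `Ψ ≤ 2` on `[1/8, 7/20]` for `L ≥ 10` (`log(2 − 3β) ≤ log 2 ≤ 0.7`). [folklore] -/
theorem psi_le_two {L β : ℝ} (hL : 10 ≤ L) (hβ : 1 / 8 ≤ β) (hβ' : β ≤ 7 / 20) :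
    (Real.log (2 - 3 * β) + 4 / L) / (1 - β) ≤ 2 := by
  have h1β : 0 < 1 - β := by linarith
  have hlog : Real.log (2 - 3 * β) ≤ Real.log 2 := Real.log_le_log (by linarith) (by linarith)
  have hlog2 := Real.log_two_lt_d9
  have h4 : 4 / L ≤ 4 / 10 := div_le_div_of_nonneg_left (by norm_num) (by norm_num) hL
  rw [div_le_iff₀ h1β]
  linarith

/-- **`Ψ` is nonincreasing on `[1/8, a]` for `a ≤ 7/20`, `L ≥ 10`.** For `β ≤ β'`:
`Ψ(β) − Ψ(β') = [(u − u')(1 − β') − u'(β' − β)]/((1−β)(1−β'))` with `u = log(2−3β) + 4/L`, and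
`u − u' = log((2−3β)/(2−3β')) ≥ 3(β'−β)/(2−3β)` (`log t ≥ 1 − 1/t`), while
`u'(2 − 3β) ≤ (log 2 + 0.4)(13/8) < 3(1 − β')`. [folklore] -/
theorem psi_antitoneOn {L a : ℝ} (hL : 10 ≤ L) (ha : a ≤ 7 / 20) :
    AntitoneOn (fun β => (Real.log (2 - 3 * β) + 4 / L) / (1 - β)) (Set.Icc (1 / 8) a) := by
  intro β hβ β' hβ' hle
  dsimp only
  have hβ1 : 1 / 8 ≤ β := hβ.1
  have hβ'2 : β' ≤ 7 / 20 := hβ'.2.trans ha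
  have hd : 0 < 2 - 3 * β := by linarith
  have hd' : 0 < 2 - 3 * β' := by linarith
  have h1β : 0 < 1 - β := by linarith
  have h1β' : 0 < 1 - β' := by linarith
  set u := Real.log (2 - 3 * β) + 4 / L with hu
  set u' := Real.log (2 - 3 * β') + 4 / L with hu'
  -- `u - u' ≥ 3(β' - β)/(2 - 3β)`
  have hdiff : 3 * (β' - β) / (2 - 3 * β) ≤ u - u' := by
    have h := Real.one_sub_inv_le_log_of_pos (div_pos hd hd')
    rw [Real.log_div hd.ne' hd'.ne', inv_div] at h
    have : 1 - (2 - 3 * β') / (2 - 3 * β) = 3 * (β' - β) / (2 - 3 * β) := by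
      field_simp
      ring
    rw [hu, hu']
    linarith
  -- `u' ≤ 1.1`
  have hu'le : u' ≤ 11 / 10 := by
    have hlog : Real.log (2 - 3 * β') ≤ Real.log 2 :=
      Real.log_le_log hd' (by linarith [hβ'.1, show (1:ℝ)/8 ≤ β' from le_trans hβ1 hle])
    have hlog2 := Real.log_two_lt_d9
    have h4 : 4 / L ≤ 4 / 10 := div_le_div_of_nonneg_left (by norm_num) (by norm_num) hL
    rw [hu']
    linarith
  -- compare
  rw [div_le_div_iff₀ h1β' h1β]
  -- goal: u' * (1 - β) ≤ u * (1 - β')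
  have hkey : 3 * (β' - β) * (1 - β') ≤ (u - u') * (2 - 3 * β) * (1 - β') := by
    have h1 : 3 * (β' - β) ≤ (u - u') * (2 - 3 * β) := by
      have := mul_le_mul_of_nonneg_right hdiff hd.le
      rwa [div_mul_cancel₀ _ hd.ne'] at this
    exact mul_le_mul_of_nonneg_right h1 h1β'.le
  have hββ' : 0 ≤ β' - β := by linarith
  nlinarith [mul_nonneg hββ' (show (0:ℝ) ≤ 3 * (1 - β') - u' * (2 - 3 * β) by nlinarith)]

/-- The switching integrand `log(2 − 3β)/(β(1 − β))` is continuous on `[a, b] ⊂ (0, 2/3)`. [folklore] -/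
theorem continuousOn_switchingIntegrand' {a b : ℝ} (ha : 0 < a) (hb : b < 2 / 3) :
    ContinuousOn (fun β : ℝ => Real.log (2 - 3 * β) / (β * (1 - β))) (Set.Icc a b) := by
  refine ContinuousOn.div ?_ (by fun_prop) ?_
  · refine ContinuousOn.log (by fun_prop) ?_
    intro x hx h0
    linarith [hx.2]
  · intro x hx h0
    rcases mul_eq_zero.mp h0 with h | h <;> linarith [hx.1, hx.2]

/-- `1/(β(1 − β))` is continuous on `[a, b] ⊂ (0, 1)`. [folklore] -/
theorem continuousOn_inv_mul_one_sub {a b : ℝ} (ha : 0 < a) (hb : b < 1) :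
    ContinuousOn (fun β : ℝ => 1 / (β * (1 - β))) (Set.Icc a b) := by
  refine continuousOn_const.div (by fun_prop) ?_
  intro x hx h0
  rcases mul_eq_zero.mp h0 with h | h <;> linarith [hx.1, hx.2]

/-- **The outer integral** (Nathanson p. 178: `∫ H(u) d log log u = c/log N`): for `L ≥ 10` and
`1/3 ≤ a ≤ 7/20`, `∫_{1/8}^{a} Ψ(β) dβ/β ≤ c + 16/L`, `c = switchingConstant`: the part of
`∫ log(2−3β)/(β(1−β))` over `[1/3, a]` is `≤ 0`, and `(4/L) ∫_{1/8}^{a} dβ/(β(1−β)) ≤ 16/L`.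
[cite: Nathanson1996, Thm 10.6 (proof, p. 178)] -/
theorem integral_psi_div_le {L a : ℝ} (hL : 10 ≤ L) (ha : 1 / 3 ≤ a) (ha' : a ≤ 7 / 20) :
    ∫ β in (1 / 8 : ℝ)..a, (Real.log (2 - 3 * β) + 4 / L) / (1 - β) / β ≤
      switchingConstant + 16 / L := by
  have hL0 : 0 < L := by linarith
  set f : ℝ → ℝ := fun β => Real.log (2 - 3 * β) / (β * (1 - β)) with hf
  set g : ℝ → ℝ := fun β => 1 / (β * (1 - β)) with hg
  have hfc : ∀ {a' b' : ℝ}, 0 < a' → b' < 2 / 3 → a' ≤ b' → IntervalIntegrable f MeasureTheory.volume a' b' :=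
    fun ha0 hb0 hab => by
      refine ContinuousOn.intervalIntegrable ?_
      rw [Set.uIcc_of_le hab]
      exact continuousOn_switchingIntegrand' ha0 hb0
  have hgc : IntervalIntegrable g MeasureTheory.volume (1 / 8) a := by
    refine ContinuousOn.intervalIntegrable ?_
    rw [Set.uIcc_of_le (by linarith)]
    exact continuousOn_inv_mul_one_sub (by norm_num) (by linarith)
  -- rewrite the integrand as `f + (4/L) g`
  have hcongr : ∫ β in (1 / 8 : ℝ)..a, (Real.log (2 - 3 * β) + 4 / L) / (1 - β) / β =
      ∫ β in (1 / 8 : ℝ)..a, (f β + 4 / L * g β) := by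
    refine intervalIntegral.integral_congr fun β hβ => ?_
    rw [Set.uIcc_of_le (by linarith)] at hβ
    have hβ0 : β ≠ 0 := by linarith [hβ.1]
    have hβ1 : 1 - β ≠ 0 := by linarith [hβ.2]
    simp only [hf, hg]
    field_simp
  rw [hcongr, intervalIntegral.integral_add (hfc (by norm_num) (by linarith) (by linarith))
    (hgc.const_mul _), intervalIntegral.integral_const_mul]
  -- the `f`-part: split at `1/3`
  have hf1 : ∫ β in (1 / 8 : ℝ)..a, f β ≤ switchingConstant := by
    rw [← intervalIntegral.integral_add_adjacent_intervals (b := 1 / 3)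
      (hfc (by norm_num) (by norm_num) (by norm_num)) (hfc (by norm_num) (by linarith) ha)]
    have h0 : ∫ β in (1 / 3 : ℝ)..a, f β ≤ 0 := by
      have hneg : 0 ≤ ∫ β in (1 / 3 : ℝ)..a, -f β := by
        refine intervalIntegral.integral_nonneg ha fun β hβ => ?_
        simp only [hf]
        have hlog : Real.log (2 - 3 * β) ≤ 0 :=
          Real.log_nonpos (by linarith [hβ.2]) (by linarith [hβ.1])
        have hden : 0 < β * (1 - β) := by nlinarith [hβ.1, hβ.2]
        have := div_nonpos_of_nonpos_of_nonneg hlog hden.le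
        linarith
      rw [intervalIntegral.integral_neg] at hneg
      linarith
    have hc : ∫ β in (1 / 8 : ℝ)..(1 / 3), f β = switchingConstant := rfl
    linarith
  -- the `g`-part
  have hg1 : ∫ β in (1 / 8 : ℝ)..a, g β ≤ 4 := by
    calc ∫ β in (1 / 8 : ℝ)..a, g β ≤ ∫ β in (1 / 8 : ℝ)..a, (16 : ℝ) := by
          refine intervalIntegral.integral_mono_on (by linarith) hgc (by simp) fun β hβ => ?_
          simp only [hg]
          have hden : 1 / 16 ≤ β * (1 - β) := by nlinarith [hβ.1, hβ.2]
          rw [div_le_iff₀ (by linarith)]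
          linarith
      _ = 16 * (a - 1 / 8) := by rw [intervalIntegral.integral_const, smul_eq_mul]; ring
      _ ≤ 4 := by linarith
  have h4L : 0 ≤ 4 / L := by positivity
  calc (∫ β in (1 / 8 : ℝ)..a, f β) + 4 / L * ∫ β in (1 / 8 : ℝ)..a, g β
      ≤ switchingConstant + 4 / L * 4 := add_le_add hf1 (mul_le_mul_of_nonneg_left hg1 h4L)
    _ = switchingConstant + 16 / L := by ring

end Literature.NumberTheory.Sieve.Chen
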